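import Summits.ResolutionOfSingularities.ResolutionOfSingularities.Theorems.PurelyInseparableDim4AtlasMemberDefsThree
import HarnessLib

/-!
# Purely inseparable four-folds: NAMES for ATLAS MEMBERS WITH LETTERS AND A SHEAR — tranche 2 of S3 (c) v4 «sheared escaping children»
# (definitions; cell `res-dim4-pi`)

[OURS · counted 0] (D-0157 DOOR 2; host item stmt-ResolutionOfSingularities-16155). Nothing here proves resolution of singularities in
dimension ≥ 4 / characteristic `p`. NO theorem content. Design: `res-dim4-typ-3/S3c-V4-ATLAS-MEMBERS-DESIGN.md` §16 (finding E-V4-4):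
a SHEARED escaping entry (centre direction `x_i = β_i x_j` inside the exceptional fibre) at a reading is the tranche-1 LINEAR entry at the
SHEARED reading — same member `V(z, x_T)`, same owned sets, state `clean(σ_β F)` for the linear shear `σ_β : x_i ↦ x_i + β_i x_j`
(`i ∈ T ∖ {j}`), which preserves `(x_T)` and fixes every boundary hyperplane `V(x_i + c)` with `β_i = 0` (G1 `zigzag_shear_reading`, p725696).
So tranche 2 = tranche 1 (`…AtlasMemberDefs` p711312 / `…DefsTwo` p713131 / `…DefsThree` p717810) PLUS:
(1) a reading carries its LETTERS `L : Finset (Fin 4 × K)` — the translated hyperplanes `V(x_i + c)` through which the boundary components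
    meeting its region are read (`AReadingL = AReading K × Finset (Fin 4 × K)`); the tables compute the children's letters
    (`mainLetters` / `extraLetters`: old `(i, c)` ↦ `(i, c + b_i)` unless `i` is the chart index or the letter misses the new centre; the new
    exceptional hyperplane `(m, 0)`), and `MemberAtlasZL` adds to tranche 1's dictionary clause that every meeting component's letter IS in `L`;
(2) a fourth table `shr : AReading K → Fin 4 × (Fin 4 → K)` = the shear `(j, β)` applied to each newly created reading (`shearState`: state
    `⟨clean(σ_β F), r, exc⟩`; `(j, 0)` = none), so that ALL entries stay tranche-1 LINEAR in their reading's coordinates; `BlockAL` = tranche 1's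
    `BlockA` at the reading (constant tables) ∧ letters format ∧ for every child reading an ADMISSIBLE shear: pivot in the new centre when
    active, `β = 0` off the new centre, and `β_i = 0` on every index `i` of the new centre carrying a letter `(i, 0)` («linear along the boundary»,
    = typ-2's hB1/hB2 after re-booking, §16 (b)).
`AEdgeL`, `MemberDataAL` are tranche 1's texts over the pair type. Not here: `j ∉ S″` children (far resonance, typ-2 R-files), v3-H merge,
general linear re-coordinatisations (G1 already allows any `(x_T)`-preserving `τ`; the one-pivot shear family is this tranche's table).

AI-produced definitions, weaker than expert review. bears_on: LADDER-RESOLUTION:D157-DOOR2 (res-dim4-pi · S3 (c) v4 tranche 2 · definitions).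
-/

set_option linter.dupNamespace false -- D-0017: single-problem summit path `Summit.<S>.<S>.…` by design

noncomputable section

open MvPolynomial Finset CategoryTheory AlgebraicGeometry Opposite TopologicalSpace
open AlgebraicGeometry.Scheme.IdealSheafData (ofIdealTop vanishingIdeal)

namespace Summit.ResolutionOfSingularities.ResolutionOfSingularities.Theorems.PIDim4

open Literature.AlgebraicGeometry.Resolution
open Literature.AlgebraicGeometry.Resolution.Hauser2010
open Literature.AlgebraicGeometry.Resolution.AffinePointBlowup (P A γ coord Wtop ξ)

namespace Equimultiple

section DefsAL

variable {K : Type} [Field K] (p : ℕ) [DecidableEq K]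

/-- A READING WITH LETTERS: a tranche-1 reading `(s, T, X, D)` and the letters `(i, c)` = translated hyperplanes `V(x_i + c)` of the boundary
components meeting its region. [cite: BierstoneGrigorievMilmanWlodarczyk2011, Def. 3.1.3 (2)] -/
abbrev AReadingL (K : Type) [Field K] : Type := AReading K × Finset (Fin 4 × K)

/-- The ONE-PIVOT SHEAR `σ_{j,β}` of `K[x₁..x₄]` inside the centre variables `T`: `x_i ↦ x_i + β_i x_j` for `i ∈ T ∖ {j}`, identity on the
other variables (as a substitution). [cite: HauserPerlega2019PRIMS, §2 (linear coordinate changes preserving P)] -/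
def shearFun (T : Finset (Fin 4)) (j : Fin 4) (β : Fin 4 → K) : Fin 4 → MvPolynomial (Fin 4) K :=
  fun i => if i ∈ T ∧ i ≠ j then X i + C (β i) * X j else X i

/-- The SHEARED STATE: substitute the shear and re-clean; history fields kept. [cite: Hauser2010, §G (coordinate change and cleaning)] -/
def shearState (T : Finset (Fin 4)) (jβ : Fin 4 × (Fin 4 → K)) (s : State K) : State K :=
  ⟨deletePthPowers p (aeval (shearFun T jβ.1 jβ.2) s.F), s.r, s.exc⟩

/-- The SHEARED READING (same centre, deferrals, bundle directions). [cite: Hauser2010, §G] -/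
def shearReading (shr : AReading K → Fin 4 × (Fin 4 → K)) (r : AReading K) : AReading K :=
  (shearState p r.2.1 (shr r) r.1, r.2)

/-- **Letters of a child reading on chart `m`** after the translation `b`, new centre `T′`: old `(i, c)` reads `(i, c + b_i)` — dropped when
`i = m` (the component leaves the chart) or when `i ∈ T′` and `c + b_i ≠ 0` (it misses the new centre); the new exceptional divisor reads
`(m, 0)`. [cite: Hauser2010, §G (transform of the exceptional components)] -/
def childLetters (m : Fin 4) (b : Fin 4 → K) (T' : Finset (Fin 4)) (L : Finset (Fin 4 × K)) : Finset (Fin 4 × K) :=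
  insert (m, (0 : K))
    (((L.filter fun ic => ic.1 ≠ m).image fun ic => (ic.1, ic.2 + b ic.1)).filter fun ic => ic.1 ∉ T' ∨ ic.2 = 0)

/-- Letters of the MAIN child reading of the entry `e = (j, b, S″)`. [cite: Hauser2010, §G] -/
def mainLetters (e : Fin 4 × (Fin 4 → K) × Finset (Fin 4)) (L : Finset (Fin 4 × K)) : Finset (Fin 4 × K) :=
  childLetters e.1 e.2.1 e.2.2 L

/-- Letters of the EXTRA child reading on chart `l` of the entry `e = (j, b, S″)` (centre `insert l (S″ ∖ {j})`). [cite: Hauser2010, §G] -/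
def extraLetters (e : Fin 4 × (Fin 4 → K) × Finset (Fin 4)) (l : Fin 4) (L : Finset (Fin 4 × K)) : Finset (Fin 4 × K) :=
  childLetters l e.2.1 (insert l (e.2.2.erase e.1)) L

/-- MAIN child reading with letters: tranche 1's `mainReading`, then the shear of record of that reading, with the main letters.
[cite: BierstoneGrigorievMilmanWlodarczyk2011, Def. 3.1.3] -/
def mainReadingL (shr : AReading K → Fin 4 × (Fin 4 → K)) (r : AReadingL K) (e : Fin 4 × (Fin 4 → K) × Finset (Fin 4)) : AReadingL K :=
  (shearReading p shr (mainReading p r.1 e), mainLetters e r.2)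

/-- EXTRA child reading on chart `l` with letters: tranche 1's `extraReading`, then its shear of record, with the extra letters.
[cite: BierstoneGrigorievMilmanWlodarczyk2011, §4 Step 2b] -/
def extraReadingL (shr : AReading K → Fin 4 × (Fin 4 → K)) (r : AReadingL K) (e : Fin 4 × (Fin 4 → K) × Finset (Fin 4)) (l : Fin 4) :
    AReadingL K :=
  (shearReading p shr (extraReading p r.1 e l), extraLetters e l r.2)

/-- Edges of the forest of readings with letters. [cite: BierstoneGrigorievMilmanWlodarczyk2011, Def. 3.1.3] -/
def AEdgeL (shr : AReading K → Fin 4 × (Fin 4 → K)) (plan : AReadingL K → Finset (Fin 4 × (Fin 4 → K) × Finset (Fin 4)))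
    (r' r : AReadingL K) : Prop :=
  ∃ e ∈ plan r, r' = mainReadingL p shr r e ∨ ∃ l ∈ r.1.2.1 \ e.2.2, r' = extraReadingL p shr r e l

/-- **An ADMISSIBLE SHEAR for a reading with centre `T′` and letters `L′`**: if active (some `β_i ≠ 0`, `i ∈ T′ ∖ {j}`) its pivot `j` lies
in `T′`; `β` vanishes off `T′ ∖ {j}`; and `β_i = 0` on every index `i ∈ T′` carrying a letter `(i, 0)` — the shear fixes every boundary
hyperplane meeting the member («linear along the boundary»). [cite: BierstoneGrigorievMilmanWlodarczyk2011, §4 Step 2b] -/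
def ShearOK (T' : Finset (Fin 4)) (L' : Finset (Fin 4 × K)) (jβ : Fin 4 × (Fin 4 → K)) : Prop :=
  ((∃ i ∈ T', i ≠ jβ.1 ∧ jβ.2 i ≠ 0) → jβ.1 ∈ T') ∧ (∀ i, (i ∉ T' ∨ i = jβ.1) → jβ.2 i = 0) ∧
  (∀ ic ∈ L', ic.1 ∈ T' → ic.2 = 0 → jβ.2 ic.1 = 0)

/-- **The block of conditions AT a reading with letters** `r = ((s, T, X, D), L)`: tranche 1's `BlockA` at `(s, T, X, D)` for the entries and
leaves booked at `r` (all entries LINEAR in `r`'s own — already sheared — coordinates), the letters format (`(i, c) ∈ L`, `i ∈ T` ⇒ `c = 0`),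
and for every entry an admissible shear of record for each of its child readings. [cite: BierstoneGrigorievMilmanWlodarczyk2011, Def. 3.1.3;
§4 Step 2b] [cite: Hauser2010, §§F–G] -/
def BlockAL (shr : AReading K → Fin 4 × (Fin 4 → K)) (plan : AReadingL K → Finset (Fin 4 × (Fin 4 → K) × Finset (Fin 4)))
    (leaves : AReadingL K → Finset (Fin 4 × (Fin 4 → K))) (r : AReadingL K) : Prop :=
  BlockA p (fun _ => plan r) (fun _ => leaves r) r.1 ∧
  (∀ ic ∈ r.2, ic.1 ∈ r.1.2.1 → ic.2 = 0) ∧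
  (∀ e ∈ plan r,
    ShearOK e.2.2 (mainLetters e r.2) (shr (mainReading p r.1 e)) ∧
    ∀ l ∈ r.1.2.1 \ e.2.2, ShearOK (insert l (e.2.2.erase e.1)) (extraLetters e l r.2) (shr (extraReading p r.1 e l)))

variable {X' : Scheme.{0}}

omit [DecidableEq K] in
/-- **Atlas clause with letters**: tranche 1's `MemberAtlasZF` per reading `r.1` (zigzag reading `M′` as `(z^p + s.F)·𝒪` and `𝓘(c)` as `𝓘Λ T`,
seeing `V(z, x_T)`, closed fibre pieces, translated-hyperplane dictionary with injective index) AND every boundary component meeting the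
reading's region is read through a letter of `r.2`; owned pieces cover `c` disjointly. [cite: BierstoneGrigorievMilmanWlodarczyk2011,
Def. 3.1.3 (2), (4)] [cite: Hauser2010, §G] -/
def MemberAtlasZL (M' : MarkedIdeal X') (c : Closeds X') (R : Finset (AReadingL K)) : Prop :=
  ∃ (Y : ↥R → Scheme.{0}) (φ : ∀ r : ↥R, Y r ⟶ X') (ψ : ∀ r : ↥R, Y r ⟶ P 4 K),
    (∀ r : ↥R, IsOpenImmersion (φ r) ∧ IsOpenImmersion (ψ r) ∧
      M'.ideal.comap (φ r) = (hypSheaf p r.1.1.1.F).comap (ψ r) ∧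
      (vanishingIdeal c).comap (φ r) = (AffineCoordBlowup.𝓘Λ 4 K (insert 0 (Fin.succ '' (r.1.1.2.1 : Set (Fin 4))))).comap (ψ r) ∧
      (AffineCoordBlowup.CΛ 4 K (insert 0 (Fin.succ '' (r.1.1.2.1 : Set (Fin 4)))) : Set (P 4 K)) ⊆ Set.range (ψ r) ∧
      (∀ v : Fin 4 → K, IsClosed (φ r '' (ψ r ⁻¹' ownedSetZ r.1.1.2.1 (r.1.1.2.2.2.image fun m => (m, v m))))) ∧
      ∃ (idx : X'.IdealSheafData → Fin 4) (cst_ : X'.IdealSheafData → K),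
        (∀ D ∈ M'.boundary,
          ((D.support : Set X') ∩ φ r '' (ψ r ⁻¹'
            (AffineCoordBlowup.CΛ 4 K (insert 0 (Fin.succ '' (r.1.1.2.1 : Set (Fin 4)))) : Set (P 4 K)))).Nonempty →
          D.comap (φ r) = (ofIdealTop (Ideal.span {(γ 4 K).symm (X (idx D).succ + C (cst_ D))})).comap (ψ r) ∧
            (idx D ∈ r.1.1.2.1 → cst_ D = 0) ∧ (idx D, cst_ D) ∈ r.1.2) ∧
        (∀ D₁ ∈ M'.boundary, ∀ D₂ ∈ M'.boundary,
          ((D₁.support : Set X') ∩ φ r '' (ψ r ⁻¹'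
            (AffineCoordBlowup.CΛ 4 K (insert 0 (Fin.succ '' (r.1.1.2.1 : Set (Fin 4)))) : Set (P 4 K)))).Nonempty →
          ((D₂.support : Set X') ∩ φ r '' (ψ r ⁻¹'
            (AffineCoordBlowup.CΛ 4 K (insert 0 (Fin.succ '' (r.1.1.2.1 : Set (Fin 4)))) : Set (P 4 K)))).Nonempty →
          idx D₁ = idx D₂ → D₁ = D₂)) ∧
    (c : Set X') ⊆ ⋃ r : ↥R, φ r '' (ψ r ⁻¹' ownedSetZ r.1.1.2.1 r.1.1.2.2.1) ∧
    ∀ r r' : ↥R, r ≠ r' →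
      Disjoint (φ r '' (ψ r ⁻¹' ownedSetZ r.1.1.2.1 r.1.1.2.2.1)) (φ r' '' (ψ r' ⁻¹' ownedSetZ r'.1.1.2.1 r'.1.1.2.2.1))

/-- **The tranche-2 datum of an ATLAS MEMBER `c`** with reading set `R : Finset (AReadingL K)`: basics per reading · format (deferred
indices are bundle directions, bundle directions are not centre variables) · `c` regular and snc with the boundary · `MemberAtlasZL` · `BlockAL`
at every reading reachable along `AEdgeL` · `Acc` of the flipped `AEdgeL`. [cite: BierstoneGrigorievMilmanWlodarczyk2011, Def. 3.1.3]
[cite: Hauser2010, §§F–G] -/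
def MemberDataAL [IsAlgClosed K] [CharP K p] [Fact p.Prime] (shr : AReading K → Fin 4 × (Fin 4 → K))
    (plan : AReadingL K → Finset (Fin 4 × (Fin 4 → K) × Finset (Fin 4)))
    (leaves : AReadingL K → Finset (Fin 4 × (Fin 4 → K)))
    (M' : MarkedIdeal X') (c : Closeds X') (R : Finset (AReadingL K)) : Prop :=
  (∀ r ∈ R, r.1.1.F ≠ 0 ∧ Literature.Barriers.ResolutionOfSingularities.HauserPerlega.IsClean p r.1.1.F ∧
    IsPermissibleCentre p r.1.2.1 r.1.1.F) ∧
  (∀ r ∈ R, (∀ iv ∈ r.1.2.2.1, iv.1 ∈ r.1.2.2.2) ∧ ∀ m ∈ r.1.2.2.2, m ∉ r.1.2.1) ∧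
  Scheme.IsRegular (vanishingIdeal c).subscheme ∧ HasSNCWith M'.boundary (vanishingIdeal c) ∧
  MemberAtlasZL p M' c R ∧
  (∀ r ∈ R, ∀ q : AReadingL K,
    Relation.ReflTransGen (fun a b : AReadingL K => AEdgeL p shr plan b a) r q → BlockAL p shr plan leaves q) ∧
  (∀ r ∈ R, Acc (fun q' q : AReadingL K => AEdgeL p shr plan q' q) r)

end DefsAL

end Equimultiple

end Summit.ResolutionOfSingularities.ResolutionOfSingularities.Theorems.PIDim4

end
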